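import Literature.MathematicalPhysics.QuantumFieldTheory.Balaban1983to89.BlockAveragingPlaquetteBoundLocal
import Summits.QuantumFields.YangMills.Theorems.FluctuationComparisonRegPrIntLS2BetaSchurTest
import HarnessLib

/-!
# S2β · `hFlat` road, UV3-NODE §57.8 (C) ∕ §64.2, the (C)-STEP's JUNK KERNEL — «THE NEIGHBOURHOOD KERNEL ON THE `Setup` TORUS»: the indicator of the `3^d` blocks
# around a coarse corner has row count `≤ 3^d·L^d·d²`, column count `≤ 3^d·d²` (Schur: bounded, not small — the junk carries the global threshold), and it controls
# every (0.4) member loop of the four bonds of a coarse plaquette LOCALLY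

Cell `ym3-torus` (rung R3 = continuum `SU(2)` Yang–Mills on the three-torus — NOT d = 4, NOT infinite volume, NOT a mass gap, NOT Clay).
Width seat «width 10» `ym3-torus-px10` (gen 22), FREE px helper on crux `stmt-QuantumFields-20520`, count-neutral, DEFINITION-FREE; pen «(C)-STEP» named by px8 g21
(08:11:35Z): «`hj` through a kernel with merely BOUNDED row∕column sums × the small θ — exactly what `keyLemma_level`'s `hj : √Σj² ≤ ε·√Σf²` wants».

THE NEIGHBOURHOOD.  For coarse sites `z, y ∈ T^{(j+1)}` write `near z y :⟺ ∀ κ, z_κ = y_κ ∨ z_κ = y_κ + 1 ∨ z_κ = y_κ − 1` (lit ✓`BlockAveragingPlaquetteBoundLocal`'s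
`ℓ^∞`-distance-`1` neighbourhood, spelled out in every statement — no `def`), and `N(y) := {q ∈ Plaq P j | near (blockOf q₋) y}` — the fine plaquettes based in the
`≤ 3^d` blocks around `y`.  Every loop word of (0.4) at any of the four bonds of the coarse plaquette `⟨y; μ, ν⟩` lies in three of these blocks (lit
✓`blockOf_walkEnd_of_count_le_loopWord`), so the LOCAL plaquette sup over `N(y)` controls every member (`dist1_loopHol_four_le_of_near`).
* §1 `near_symm`, `near_of_mem_nine` (the nine coarse sites of the lit local form are near), ★ `card_near_le` (`#{z | near z y} ≤ 3^d`).
* §2 plaquette counts: `card_filter_src_mem_le` (`#{q | q₋ ∈ X} ≤ |X|·d²`), `card_filter_blockOf_mem_le` (`≤ |S|·L^d·d²`), ★ `card_nbhd_le` (ROW COUNT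
  `#N(y) ≤ 3^d·L^d·d²`), ★ `card_conbhd_le` (COLUMN COUNT: a fine plaquette lies in `N(Q₋)` for at most `3^d·d²` coarse plaquettes `Q`).
* §3 ★★ `nbhd_schur` — `Σ_Q (Σ_{q ∈ N(Q₋)} g q)² ≤ (3^d·L^d·d²)·(3^d·d²)·Σ_q g q²` (✓p816252 `schur_test_sq`), and ★★ `sqrt_sum_sq_le_of_le_nbhd_sum` — the `hj` SHAPE of ✓G11
  `keyLemma_level`: `0 ≤ J Q ≤ c·Σ_{q ∈ N(Q₋)} g q` for all `Q` ⟹ `√(Σ_Q J Q²) ≤ c·√((3^d L^d d²)(3^d d²))·√(Σ_q g q²)`.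
* §4 ★ `dist1_loopHol_four_le_of_near` — LOCAL MEMBER SIZES: if every `q ∈ N(y)` has `dist1 U(∂q) < a` then every (0.4) member loop of each of the four bonds
  `⟨y,μ⟩, ⟨y+e_μ,ν⟩, ⟨y+e_ν,μ⟩, ⟨y,ν⟩` has `dist1 ≤ (((d+2)L)²∕4)·a` (lit ✓`dist1_loopHol_le_local`); `lt_nbhd_sum_add` — the sup may be taken `a := Σ_{q∈N(y)} dist1 U(∂q) + η`.

HONEST SCOPE.  Finite combinatorics on the `Setup` torus + one call of the lit local Stokes bound; no analysis; nothing of Bałaban's is asserted; the (C)-STEP's composition,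
the KEY LEMMA, `hFlat`, TUBE-REG∘, GAP♯∘, S2β, crux 20520 and `YM3TorusSU2` are NOT proved; no registered stub is closed; the Yang–Mills mass gap is NOT proved.
References: T. Bałaban, CMP **109** (1987) 249–301 [Balaban1987RG1] ((0.3)–(0.4) pp.252–253); CMP **98** (1985) 17–51 [Balaban1985Averaging] ((19) p.21).
-/

set_option autoImplicit false

noncomputable section

namespace Summit.QuantumFields.YangMills.Theorems.FluctuationComparisonRegPrIntLS2BetaNeighbourhoodKernelTorus

open Finset
open Literature.MathematicalPhysics.QuantumFieldTheory.Balaban1983to89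
open Literature.MathematicalPhysics.QuantumFieldTheory.Balaban1983to89.T4Continuum
open Literature.MathematicalPhysics.QuantumFieldTheory.Balaban1983to89.BlockAveraging
open Literature.MathematicalPhysics.QuantumFieldTheory.Balaban1983to89.BlockAveragingPlaquetteBoundLocal (dist1_loopHol_le_local)
open Summit.QuantumFields.YangMills.Theorems.FluctuationComparisonRegPrIntLS2BetaSchurTest (schur_test_sq)

variable {P : Params} {j k : ℕ}

/-! ## §1 The `ℓ^∞`-distance-`1` neighbourhood of a coarse site -/

/-- `near` is symmetric (up to the order of the disjuncts). [folklore] -/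
theorem near_symm {z y : Site P k} (h : ∀ κ, z κ = y κ ∨ z κ = y κ + 1 ∨ z κ = y κ - 1) :
    ∀ κ, y κ = z κ ∨ y κ = z κ + 1 ∨ y κ = z κ - 1 := by
  intro κ
  rcases h κ with h1 | h1 | h1
  · exact Or.inl h1.symm
  · right; right; rw [h1]; ring
  · right; left; rw [h1]; ring

/-- The nine coarse sites of the lit local form (`y`, `y ± e_μ`, `y ± e_ν`, `y + e_μ + e_ν` (both orders), `y + e_μ − e_ν`, `y + e_ν − e_μ`) are near `y`. [folklore] -/
theorem near_of_mem_nine (y : Site P k) {μ ν : Fin P.d} (hμν : μ ≠ ν) {z : Site P k}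
    (hz : z ∈ [y, y.shift μ, y.unshift μ, y.shift ν, y.unshift ν, (y.shift μ).shift ν, (y.shift ν).shift μ, (y.shift μ).unshift ν,
      (y.shift ν).unshift μ]) :
    ∀ κ, z κ = y κ ∨ z κ = y κ + 1 ∨ z κ = y κ - 1 := by
  intro κ
  simp only [List.mem_cons, List.mem_nil_iff, or_false] at hz
  rcases hz with rfl | rfl | rfl | rfl | rfl | rfl | rfl | rfl | rfl <;>
    by_cases hκμ : κ = μ <;> by_cases hκν : κ = ν <;>
    simp_all [Site.shift_apply, Site.unshift_apply]

/-- ★ **AT MOST `3^d` COARSE SITES ARE NEAR A GIVEN ONE**: they are the images of `{0, +1, −1}^d`. [folklore] -/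
theorem card_near_le (y : Site P k) :
    (Finset.univ.filter (fun z : Site P k => ∀ κ, z κ = y κ ∨ z κ = y κ + 1 ∨ z κ = y κ - 1)).card ≤ 3 ^ P.d := by
  classical
  let c : Fin 3 → ZMod (P.sitesPerDir k) := fun t => if t = 0 then 0 else if t = 1 then 1 else -1
  have hsub : Finset.univ.filter (fun z : Site P k => ∀ κ, z κ = y κ ∨ z κ = y κ + 1 ∨ z κ = y κ - 1) ⊆
      (Finset.univ : Finset (Fin P.d → Fin 3)).image (fun e => fun κ => y κ + c (e κ)) := by
    intro z hz
    rw [Finset.mem_filter] at hz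
    rw [Finset.mem_image]
    refine ⟨fun κ => if z κ = y κ then 0 else if z κ = y κ + 1 then 1 else 2, Finset.mem_univ _, ?_⟩
    funext κ
    rcases hz.2 κ with h | h | h
    · simp [c, h]
    · by_cases h0 : z κ = y κ
      · simp [c, h0]
      · simp [c, h]
    · by_cases h0 : z κ = y κ
      · simp [c, h0]
      · by_cases h1 : z κ = y κ + 1
        · simp [c, h1]
        · simp only [c, h0, h1, if_false, show (2 : Fin 3) ≠ 0 from by decide, show (2 : Fin 3) ≠ 1 from by decide]
          rw [h]; ring
  refine (Finset.card_le_card hsub).trans (Finset.card_image_le.trans ?_)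
  rw [Finset.card_univ, Fintype.card_fun, Fintype.card_fin, Fintype.card_fin]

/-! ## §2 Plaquette counts: row and column sums of the neighbourhood kernel -/

/-- A plaquette is determined by its source and its two directions: `#{q | q₋ ∈ X} ≤ |X|·d²`. [folklore] -/
theorem card_filter_src_mem_le (X : Finset (Site P k)) :
    (Finset.univ.filter (fun q : Plaq P k => q.src ∈ X)).card ≤ X.card * P.d ^ 2 := by
  classical
  have h := Finset.card_le_card_of_injOn (s := Finset.univ.filter (fun q : Plaq P k => q.src ∈ X))
    (t := X ×ˢ ((Finset.univ : Finset (Fin P.d)) ×ˢ (Finset.univ : Finset (Fin P.d))))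
    (fun q => (q.src, q.μ, q.ν)) (fun q hq => by
      rw [Finset.coe_filter] at hq
      simp only [Finset.coe_product, Finset.coe_univ, Set.mem_prod, Finset.mem_coe, Set.mem_univ, and_true]
      exact hq.2)
    (fun q _ q' _ heq => by
      obtain ⟨s, a, b, hab⟩ := q
      obtain ⟨s', a', b', hab'⟩ := q'
      simp only [Prod.mk.injEq] at heq
      obtain ⟨rfl, rfl, rfl⟩ := heq
      rfl)
  refine h.trans (le_of_eq ?_)
  rw [Finset.card_product, Finset.card_product, Finset.card_univ, Fintype.card_fin, sq]

/-- `#{q | blockOf q₋ ∈ S} ≤ |S|·L^d·d²` (the blocks have `L^d` sites; standing range). [cite: Balaban1987RG1, (0.3) p.252] -/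
theorem card_filter_blockOf_mem_le (hj : j + 1 ≤ P.m + P.K) (S : Finset (Site P (j + 1))) :
    (Finset.univ.filter (fun q : Plaq P j => blockOf q.src ∈ S)).card ≤ S.card * P.L ^ P.d * P.d ^ 2 := by
  classical
  have hX : (S.biUnion block).card ≤ S.card * P.L ^ P.d := by
    refine Finset.card_biUnion_le.trans (le_of_eq ?_)
    rw [Finset.sum_congr rfl fun z _ => Site.card_block hj z, Finset.sum_const, smul_eq_mul]
  have hsub : Finset.univ.filter (fun q : Plaq P j => blockOf q.src ∈ S) ⊆ Finset.univ.filter (fun q : Plaq P j => q.src ∈ S.biUnion block) := by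
    intro q hq
    rw [Finset.mem_filter] at hq ⊢
    refine ⟨hq.1, Finset.mem_biUnion.mpr ⟨blockOf q.src, hq.2, ?_⟩⟩
    simp [block]
  calc (Finset.univ.filter (fun q : Plaq P j => blockOf q.src ∈ S)).card
      ≤ (Finset.univ.filter (fun q : Plaq P j => q.src ∈ S.biUnion block)).card := Finset.card_le_card hsub
    _ ≤ (S.biUnion block).card * P.d ^ 2 := card_filter_src_mem_le _
    _ ≤ S.card * P.L ^ P.d * P.d ^ 2 := Nat.mul_le_mul_right _ hX

/-- ★ **ROW COUNT of the neighbourhood kernel**: `#N(y) = #{q | near (blockOf q₋) y} ≤ 3^d·L^d·d²` (standing range). [cite: Balaban1987RG1, (0.3) p.252] -/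
theorem card_nbhd_le (hj : j + 1 ≤ P.m + P.K) (y : Site P (j + 1)) :
    (Finset.univ.filter (fun q : Plaq P j => ∀ κ, blockOf q.src κ = y κ ∨ blockOf q.src κ = y κ + 1 ∨ blockOf q.src κ = y κ - 1)).card ≤
      3 ^ P.d * P.L ^ P.d * P.d ^ 2 := by
  classical
  set S := Finset.univ.filter (fun z : Site P (j + 1) => ∀ κ, z κ = y κ ∨ z κ = y κ + 1 ∨ z κ = y κ - 1) with hS
  have e : Finset.univ.filter (fun q : Plaq P j => ∀ κ, blockOf q.src κ = y κ ∨ blockOf q.src κ = y κ + 1 ∨ blockOf q.src κ = y κ - 1) =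
      Finset.univ.filter (fun q : Plaq P j => blockOf q.src ∈ S) := by
    ext q; simp [hS]
  rw [e]
  exact (card_filter_blockOf_mem_le hj S).trans (Nat.mul_le_mul_right _ (Nat.mul_le_mul_right _ (card_near_le y)))

/-- ★ **COLUMN COUNT of the neighbourhood kernel**: a fine plaquette `q` lies in `N(Q₋)` for at most `3^d·d²` coarse plaquettes `Q` (the coarse corners near
`blockOf q₋`, times the directions). [cite: Balaban1987RG1, (0.3) p.252] -/
theorem card_conbhd_le (q : Plaq P j) :
    (Finset.univ.filter (fun Q : Plaq P (j + 1) => ∀ κ, blockOf q.src κ = Q.src κ ∨ blockOf q.src κ = Q.src κ + 1 ∨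
      blockOf q.src κ = Q.src κ - 1)).card ≤ 3 ^ P.d * P.d ^ 2 := by
  classical
  set S := Finset.univ.filter (fun z : Site P (j + 1) => ∀ κ, z κ = blockOf q.src κ ∨ z κ = blockOf q.src κ + 1 ∨ z κ = blockOf q.src κ - 1)
    with hS
  have hsub : Finset.univ.filter (fun Q : Plaq P (j + 1) => ∀ κ, blockOf q.src κ = Q.src κ ∨ blockOf q.src κ = Q.src κ + 1 ∨
      blockOf q.src κ = Q.src κ - 1) ⊆ Finset.univ.filter (fun Q : Plaq P (j + 1) => Q.src ∈ S) := by
    intro Q hQ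
    rw [Finset.mem_filter] at hQ ⊢
    refine ⟨hQ.1, ?_⟩
    rw [hS, Finset.mem_filter]
    exact ⟨Finset.mem_univ _, near_symm hQ.2⟩
  exact (Finset.card_le_card hsub).trans ((card_filter_src_mem_le S).trans (Nat.mul_le_mul_right _ (card_near_le _)))

/-! ## §3 The Schur bound for the neighbourhood kernel; the `hj` shape of the KEY LEMMA skeleton -/

/-- ★★ **SCHUR BOUND FOR THE NEIGHBOURHOOD KERNEL** (✓`…S2BetaSchurTest.schur_test_sq` with the indicator kernel, row count `≤ 3^d·L^d·d²`, column count `≤ 3^d·d²`):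
`Σ_Q (Σ_{q ∈ N(Q₋)} g q)² ≤ (3^d·L^d·d²)·(3^d·d²)·Σ_q g q²` — BOUNDED, polynomial in `L`; all the (C)-STEP's junk needs, since it carries the global threshold.
[cite: Balaban1985Averaging, (19) p.21] -/
theorem nbhd_schur (hj : j + 1 ≤ P.m + P.K) (g : Plaq P j → ℝ) :
    ∑ Q : Plaq P (j + 1), (∑ q ∈ Finset.univ.filter (fun q : Plaq P j => ∀ κ, blockOf q.src κ = Q.src κ ∨ blockOf q.src κ = Q.src κ + 1 ∨
        blockOf q.src κ = Q.src κ - 1), g q) ^ 2 ≤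
      ((3 ^ P.d * P.L ^ P.d * P.d ^ 2 : ℕ) : ℝ) * ((3 ^ P.d * P.d ^ 2 : ℕ) : ℝ) * ∑ q : Plaq P j, g q ^ 2 := by
  classical
  have h := schur_test_sq (Finset.univ : Finset (Plaq P (j + 1))) (Finset.univ : Finset (Plaq P j))
    (fun Q q => if (∀ κ, blockOf q.src κ = Q.src κ ∨ blockOf q.src κ = Q.src κ + 1 ∨ blockOf q.src κ = Q.src κ - 1) then (1 : ℝ) else 0)
    (fun Q _ q _ => by positivity) (R := ((3 ^ P.d * P.L ^ P.d * P.d ^ 2 : ℕ) : ℝ)) (C := ((3 ^ P.d * P.d ^ 2 : ℕ) : ℝ)) (by positivity)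
    (fun Q _ => by
      rw [← Finset.sum_filter, Finset.sum_const, nsmul_eq_mul, mul_one]
      exact_mod_cast card_nbhd_le hj Q.src)
    (fun q _ => by
      rw [← Finset.sum_filter, Finset.sum_const, nsmul_eq_mul, mul_one]
      exact_mod_cast card_conbhd_le q) g
  simp only [ite_mul, one_mul, zero_mul, Finset.sum_ite, Finset.sum_const_zero, add_zero] at h
  convert h using 4

/-- ★★ **THE `hj` SHAPE**: if a non-negative coarse-plaquette function is dominated by `c ×` the neighbourhood sum of a fine-plaquette function, its `ℓ²` norm is dominated
by `c·√((3^d L^d d²)(3^d d²)) ×` the `ℓ²` norm — the `hj : √(Σ j²) ≤ ε·√(Σ f²)` input of ✓`…KeyLemmaSkeleton.keyLemma_level` with `ε = c·C_N(d,L)`.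
[cite: Balaban1985Averaging, (19) p.21] -/
theorem sqrt_sum_sq_le_of_le_nbhd_sum (hj : j + 1 ≤ P.m + P.K) (g : Plaq P j → ℝ) (J : Plaq P (j + 1) → ℝ) {c : ℝ} (hc : 0 ≤ c)
    (hJ0 : ∀ Q, 0 ≤ J Q)
    (hJ : ∀ Q, J Q ≤ c * ∑ q ∈ Finset.univ.filter (fun q : Plaq P j => ∀ κ, blockOf q.src κ = Q.src κ ∨ blockOf q.src κ = Q.src κ + 1 ∨
        blockOf q.src κ = Q.src κ - 1), g q) :
    √(∑ Q : Plaq P (j + 1), J Q ^ 2) ≤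
      c * √(((3 ^ P.d * P.L ^ P.d * P.d ^ 2 : ℕ) : ℝ) * ((3 ^ P.d * P.d ^ 2 : ℕ) : ℝ)) * √(∑ q : Plaq P j, g q ^ 2) := by
  have h1 : ∑ Q : Plaq P (j + 1), J Q ^ 2 ≤ c ^ 2 * ∑ Q : Plaq P (j + 1), (∑ q ∈ Finset.univ.filter (fun q : Plaq P j => ∀ κ,
      blockOf q.src κ = Q.src κ ∨ blockOf q.src κ = Q.src κ + 1 ∨ blockOf q.src κ = Q.src κ - 1), g q) ^ 2 := by
    rw [Finset.mul_sum]
    refine Finset.sum_le_sum fun Q _ => ?_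
    rw [← mul_pow]
    exact pow_le_pow_left₀ (hJ0 Q) (hJ Q) 2
  have h2 := nbhd_schur hj g
  calc √(∑ Q : Plaq P (j + 1), J Q ^ 2)
      ≤ √(c ^ 2 * (((3 ^ P.d * P.L ^ P.d * P.d ^ 2 : ℕ) : ℝ) * ((3 ^ P.d * P.d ^ 2 : ℕ) : ℝ) * ∑ q : Plaq P j, g q ^ 2)) :=
        Real.sqrt_le_sqrt (h1.trans (mul_le_mul_of_nonneg_left h2 (sq_nonneg c)))
    _ = c * √(((3 ^ P.d * P.L ^ P.d * P.d ^ 2 : ℕ) : ℝ) * ((3 ^ P.d * P.d ^ 2 : ℕ) : ℝ)) * √(∑ q : Plaq P j, g q ^ 2) := by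
        rw [Real.sqrt_mul (sq_nonneg c), Real.sqrt_sq hc, Real.sqrt_mul (by positivity)]; ring

/-! ## §4 Local member sizes: the neighbourhood controls every (0.4) loop of the four bonds -/

variable {G : Type*} [GaugeGroup G]

/-- ★ **LOCAL MEMBER SIZES**: if every fine plaquette based in a block near `y` is within `a ≥ 0` of `1`, then every member loop of (0.4) at each of the four bonds
`⟨y, μ⟩`, `⟨y + e_μ, ν⟩`, `⟨y + e_ν, μ⟩`, `⟨y, ν⟩` of the coarse plaquette `⟨y; μ, ν⟩` satisfies `dist1 ≤ (((d+2)L)²∕4)·a` (lit `dist1_loopHol_le_local`: each loop word lies in the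
three blocks `c₋ − e, c₋, c₊` of its bond, all near `y`; standing range). [cite: Balaban1987RG1, (0.4) p.253] -/
theorem dist1_loopHol_four_le_of_near (hj : j + 1 ≤ P.m + P.K) (U : GaugeField P j G) (Q : Plaq P (j + 1)) {a : ℝ} (ha : 0 ≤ a)
    (hU : ∀ q : Plaq P j, (∀ κ, blockOf q.src κ = Q.src κ ∨ blockOf q.src κ = Q.src κ + 1 ∨ blockOf q.src κ = Q.src κ - 1) →
      dist1 (GaugeField.plaqHol U q) < a) (i : Idx P) :
    dist1 (loopHol U ⟨Q.src, Q.μ⟩ i) ≤ ((((P.d + 2) * P.L : ℕ) : ℝ) ^ 2 / 4) * a ∧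
      dist1 (loopHol U ⟨Q.src.shift Q.μ, Q.ν⟩ i) ≤ ((((P.d + 2) * P.L : ℕ) : ℝ) ^ 2 / 4) * a ∧
      dist1 (loopHol U ⟨Q.src.shift Q.ν, Q.μ⟩ i) ≤ ((((P.d + 2) * P.L : ℕ) : ℝ) ^ 2 / 4) * a ∧
      dist1 (loopHol U ⟨Q.src, Q.ν⟩ i) ≤ ((((P.d + 2) * P.L : ℕ) : ℝ) ^ 2 / 4) * a := by
  have hne : Q.μ ≠ Q.ν := ne_of_lt Q.hμν
  have key : ∀ c : PBond P (j + 1), (c.src.unshift c.dir ∈ [Q.src, Q.src.shift Q.μ, Q.src.unshift Q.μ, Q.src.shift Q.ν, Q.src.unshift Q.ν,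
        (Q.src.shift Q.μ).shift Q.ν, (Q.src.shift Q.ν).shift Q.μ, (Q.src.shift Q.μ).unshift Q.ν, (Q.src.shift Q.ν).unshift Q.μ]) →
      (c.src ∈ [Q.src, Q.src.shift Q.μ, Q.src.unshift Q.μ, Q.src.shift Q.ν, Q.src.unshift Q.ν,
        (Q.src.shift Q.μ).shift Q.ν, (Q.src.shift Q.ν).shift Q.μ, (Q.src.shift Q.μ).unshift Q.ν, (Q.src.shift Q.ν).unshift Q.μ]) →
      (c.tgt ∈ [Q.src, Q.src.shift Q.μ, Q.src.unshift Q.μ, Q.src.shift Q.ν, Q.src.unshift Q.ν,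
        (Q.src.shift Q.μ).shift Q.ν, (Q.src.shift Q.ν).shift Q.μ, (Q.src.shift Q.μ).unshift Q.ν, (Q.src.shift Q.ν).unshift Q.μ]) →
      dist1 (loopHol U c i) ≤ ((((P.d + 2) * P.L : ℕ) : ℝ) ^ 2 / 4) * a := fun c h1 h2 h3 =>
    dist1_loopHol_le_local ha hj c (fun q hq => hU q (by
      rcases hq with hq | hq | hq <;> rw [hq]
      · exact near_of_mem_nine Q.src hne h1
      · exact near_of_mem_nine Q.src hne h2
      · exact near_of_mem_nine Q.src hne h3)) i
  refine ⟨key ⟨Q.src, Q.μ⟩ (by simp) (by simp) (by simp [PBond.tgt]),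
    key ⟨Q.src.shift Q.μ, Q.ν⟩ (by simp) (by simp) (by simp [PBond.tgt]),
    key ⟨Q.src.shift Q.ν, Q.μ⟩ (by simp) (by simp) (by simp [PBond.tgt]),
    key ⟨Q.src, Q.ν⟩ (by simp) (by simp) (by simp [PBond.tgt])⟩

/-- The local sup may be taken to be the neighbourhood SUM (plus any `η > 0`): every `q ∈ N(y)` has `dist1 U(∂q) < Σ_{q′ ∈ N(y)} dist1 U(∂q′) + η`. [folklore] -/
theorem lt_nbhd_sum_add (U : GaugeField P j G) (y : Site P (j + 1)) {η : ℝ} (hη : 0 < η) (q : Plaq P j)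
    (hq : ∀ κ, blockOf q.src κ = y κ ∨ blockOf q.src κ = y κ + 1 ∨ blockOf q.src κ = y κ - 1) :
    dist1 (GaugeField.plaqHol U q) <
      (∑ q' ∈ Finset.univ.filter (fun q' : Plaq P j => ∀ κ, blockOf q'.src κ = y κ ∨ blockOf q'.src κ = y κ + 1 ∨ blockOf q'.src κ = y κ - 1),
        dist1 (GaugeField.plaqHol U q')) + η := by
  have hmem : q ∈ Finset.univ.filter (fun q' : Plaq P j => ∀ κ, blockOf q'.src κ = y κ ∨ blockOf q'.src κ = y κ + 1 ∨ blockOf q'.src κ = y κ - 1) :=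
    Finset.mem_filter.mpr ⟨Finset.mem_univ _, hq⟩
  have h := Finset.single_le_sum (f := fun q' : Plaq P j => dist1 (GaugeField.plaqHol U q')) (fun q' _ => GaugeGroup.dist1_nonneg _) hmem
  linarith

end Summit.QuantumFields.YangMills.Theorems.FluctuationComparisonRegPrIntLS2BetaNeighbourhoodKernelTorus

end
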